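import Summits.QuantumFields.YangMills.Theses.SqueezedSkewness

/-!
# Birth skeleton for `SqueezedSkewness.TorusKL` (rev 11 item; planner ym-idea-6 g10, LINE α «torus-direct Källén–Lehmann»)

Two registered stubs and the kernel-checked composition
`TorusKL_of : stub_torusMixtureData-statement → stub_mixedParseval-statement → TorusKL`.  No summit / NT statement is
proved here; `TorusKL` is a lattice theorem (finite-period transfer-matrix identity), bears_on R2a = BalabanLadder.NT only
through the route's `closes`.

* `stub_torusMixtureData` (L): the Osterwalder–Schrader / transfer-operator data of the site reflection ON THE TORUS of
  period `T`, realised on `ℓ²(ℕ, ℂ)` as a MIXTURE over reference states `i` (the eigenvectors of the positive transfer operator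
  `𝕋` of the spatial torus `(2L+1)³`, thermal weights `p i = λ_i^T / Z_T`, `Z_T = Tr 𝕋^T`): for each `i` a positive self-adjoint
  compact operator `P i` (`= 𝕋/λ_i` on `e_i^⊥` — NOT a contraction: the image / 'around-the-world' atoms are its eigenvalues
  `> 1`), a unitary representation `U i` of `ℤ³` through `(ℤ/(2L+1))³` commuting with `P i`, ONE vector
  `ψ i = [(â + λ_i⁻¹ 𝕋_E)(0⃗) e_i]^⊥` (magnetic plaquettes = multiplication operators on a slice, electric ones = the one-step
  kernel in the adjacent slot, whence the `λ_i⁻¹`; the pair term is a perfect square), and the diagonal variance weight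
  `W₀ = Var_p ⟨e_i, (â + λ_i⁻¹𝕋_E)(0⃗) e_i⟩ ≥ 0`, such that for every test function of heights in `(0, H]`, `2H + 3s ≤ sT`
  (both arcs of the circle free of insertions), inside the open spatial fundamental cube,
  `Qrp β (2L+1) T s f − W₀ (Σ_x f(sx))² = Σ_i p_i ‖Σ_x f(sx) (P i)^(x₀−1) (U i x⃗) (ψ i)‖²`
  (Markov property = site RP [Luscher1977, OsterwalderSeilerAnnPhys1978]; `Z_T = Tr 𝕋^T` [MontvayMunster1994 (3.145)]).
* `stub_mixedParseval` (M): pure operator theory — for EACH `i` the joint orthonormal eigenbasis of `(P i, U i)` and Parseval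
  (= `stub_jointDiagonal` of `Lines/spectral_identification_l_birth.lean` WITHOUT the hypothesis `‖P‖ ≤ 1`, so `μ ≥ 0` only),
  then the countable non-negative double family `W_(i,m) = p_i |⟪e_m^(i), ψ i⟫|²` re-indexed by `ℕ` together with the atom
  `(W₀, μ = 1, q = 0)` gives the `HasSum` of `TorusKL` for an arbitrary functional `Q`.
BC3 probes: neither stub is the crux or NT in costume (stub 1 has no atomic form, stub 2 no lattice measure). -/

set_option autoImplicit false

namespace Summit.QuantumFields.YangMills.Cruxes.NT.TorusKLBirth

open Summit.QuantumFields.YangMills.Theses.SqueezedSkewness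

/-! ## Name-keyed statements of the two registered stubs -/
namespace __Registered

/-- Statement of `stub_torusMixtureData` (L): torus OS / transfer-operator data on ℓ²(ℕ) as a thermal mixture, with the
finite-period covariance identity (variance atom split off). -/
abbrev stub_torusMixtureData : Prop :=
  ∀ (G : Type) [Group G] [TopologicalSpace G] [IsTopologicalGroup G] [CompactSpace G], letI : MeasurableSpace G := borel G; haveI : BorelSpace G := ⟨rfl⟩; ∀ (r : Literature.MathematicalPhysics.QuantumFieldTheory.LatticeRep G), let St : ℕ → ℕ → Type := fun S T => Literature.MathematicalPhysics.QuantumFieldTheory.FinTorusSite S S S T; let Cfg : ℕ → ℕ → Type := fun S T => Literature.MathematicalPhysics.QuantumFieldTheory.FinTorusSite S S S T × Fin 4 → G; let cc : (n : ℕ) → Fin n → ℤ := fun n i => if 2 * i.val < n then (i.val : ℤ) else (i.val : ℤ) - n; let posE : (S T : ℕ) → St S T → EuclideanSpace ℝ (Fin 4) := fun S T x => Literature.MathematicalPhysics.QuantumLattice.siteToE (d := 4) ![cc T x.2.2.2, cc S x.1, cc S x.2.1, cc S x.2.2.1]; let P : (S T : ℕ) → St S T → Fin 4 → Fin 4 →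 Cfg S T → ℝ := fun _ _ x i j U => (r.ρ (Literature.MathematicalPhysics.QuantumFieldTheory.finTorusPlaquette U x i j)).trace.re; let A : (S T : ℕ) → St S T → Cfg S T → ℝ := fun S T x U => ∑ q : {q : Fin 4 × Fin 4 // q.1 < q.2}, P S T x q.1.1 q.1.2 U; let w : ℝ → (S T : ℕ) → Cfg S T → ℝ := fun β S T U => Real.exp (-β * ∑ x : St S T, ∑ q : {q : Fin 4 × Fin 4 // q.1 < q.2}, ((r.N : ℝ) - P S T x q.1.1 q.1.2 U)); let E : ℝ → (S T : ℕ) → (Cfg S T → ℝ) → ℝ := fun β S T F => (∫ U : Literature.MathematicalPhysics.QuantumFieldTheory.FinTorusSite S S S T × Fin 4 → G, F U * w β S T U ∂MeasureTheory.Measure.pi (fun _ => Literature.MathematicalPhysics.QuantumFieldTheory.haarProbability G)) / Literature.MathematicalPhysics.QuantumFieldTheory.wilsonFinTorusPartition r.ρ β S S S T; let Cov : ℝ → (S T : ℕ) → (Cfg S T → ℝ) → (Cfg S T → ℝ) → ℝ := fun β S T F F' => E β S T (fun U => F U * F' U) - E β S T F * E β S T F'; let refl : (S T : ℕ) → Cfg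 S T → Cfg S T := fun _ T U e => if e.2 = Fin.last 3 then (U ((e.1.1, e.1.2.1, e.1.2.2.1, Fin.rev e.1.2.2.2), Fin.last 3))⁻¹ else U ((e.1.1, e.1.2.1, e.1.2.2.1, ⟨(T - e.1.2.2.2.val) % T, Nat.mod_lt _ e.1.2.2.2.pos⟩), e.2); let B : (S T : ℕ) → ℝ → SchwartzMap (EuclideanSpace ℝ (Fin 4)) ℝ → Cfg S T → ℝ := fun S T s f U => ∑ x : St S T, f (s • posE S T x) * A S T x U; let Qrp : ℝ → (S T : ℕ) → ℝ → SchwartzMap (EuclideanSpace ℝ (Fin 4)) ℝ → ℝ := fun β S T s f => Cov β S T (fun U => B S T s f (refl S T U)) (B S T s f); let amp : ℝ → SchwartzMap (EuclideanSpace ℝ (Fin 4)) ℝ → ℝ → (Fin 3 → ℝ) → ℂ := fun s f μ p => ∑' x : Fin 4 → ℤ, (((f (s • Literature.MathematicalPhysics.QuantumLattice.siteToE (d := 4) x) * μ ^ (Int.toNat (x 0 - 1))) : ℝ) : ℂ) * Complex.exp (Complex.I * ((s * ∑ k : Fin 3, p k * (x k.succ : ℝ) : ℝ) : ℂ)); ∀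 (β : ℝ) (L T : ℕ) (s : ℝ), 0 ≤ β → 1 ≤ L → 1 ≤ T → 0 < s → ∃ (p : ℕ → ℝ) (W₀ : ℝ) (P : ℕ → (lp (fun _ : ℕ => ℂ) 2 →L[ℂ] lp (fun _ : ℕ => ℂ) 2)) (U : ℕ → (Fin 3 → ℤ) → (lp (fun _ : ℕ => ℂ) 2 →L[ℂ] lp (fun _ : ℕ => ℂ) 2)) (ψ : ℕ → lp (fun _ : ℕ => ℂ) 2), (∀ i, 0 ≤ p i) ∧ 0 ≤ W₀ ∧ (∀ i : ℕ, IsSelfAdjoint (P i) ∧ IsCompactOperator (P i) ∧ (∀ v : lp (fun _ : ℕ => ℂ) 2, 0 ≤ RCLike.re (inner ℂ (P i v) v)) ∧ U i 0 = 1 ∧ (∀ x y : Fin 3 → ℤ, U i (x + y) = U i x * U i y) ∧ (∀ x y : Fin 3 → ℤ, (∀ k, ((x k : ℤ) : ZMod (2 * L + 1)) = ((y k : ℤ) : ZMod (2 * L + 1))) → U i x = U i y) ∧ (∀ (x : Fin 3 → ℤ) (v : lp (fun _ : ℕ => ℂ) 2), ‖U i x v‖ = ‖v‖) ∧ (∀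 x : Fin 3 → ℤ, P i * U i x = U i x * P i)) ∧ ∀ (H : ℝ) (f : SchwartzMap (EuclideanSpace ℝ (Fin 4)) ℝ), 2 * H + 3 * s ≤ s * T → tsupport (f : EuclideanSpace ℝ (Fin 4) → ℝ) ⊆ {y : EuclideanSpace ℝ (Fin 4) | 0 < y 0 ∧ y 0 ≤ H} → tsupport (f : EuclideanSpace ℝ (Fin 4) → ℝ) ⊆ {y : EuclideanSpace ℝ (Fin 4) | ∀ i : Fin 3, |y i.succ| < s * (L + 1 / 2)} → HasSum (fun i : ℕ => p i * ‖(∑' x : Fin 4 → ℤ, ((f (s • Literature.MathematicalPhysics.QuantumLattice.siteToE (d := 4) x) : ℝ) : ℂ) • ((P i ^ (Int.toNat (x 0 - 1))) ((U i (fun k : Fin 3 => x k.succ)) (ψ i))))‖ ^ 2) (Qrp β (2 * L + 1) T s f - W₀ * (∑' x : Fin 4 → ℤ, f (s • Literature.MathematicalPhysics.QuantumLattice.siteToE (d := 4) x)) ^ 2)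

/-- Statement of `stub_mixedParseval` (M): per-reference-state joint diagonalisation + Parseval, mixed with weights `p i`,
plus the variance atom ⇒ the Källén–Lehmann `HasSum` with `W ≥ 0`, `μ ≥ 0` and reciprocal-lattice momenta. -/
abbrev stub_mixedParseval : Prop :=
  ∀ (L T : ℕ) (s : ℝ), 1 ≤ L → 1 ≤ T → 0 < s → ∀ (Q : SchwartzMap (EuclideanSpace ℝ (Fin 4)) ℝ → ℝ) (p : ℕ → ℝ) (W₀ : ℝ) (P : ℕ → (lp (fun _ : ℕ => ℂ) 2 →L[ℂ] lp (fun _ : ℕ => ℂ) 2)) (U : ℕ → (Fin 3 → ℤ) → (lp (fun _ : ℕ => ℂ) 2 →L[ℂ] lp (fun _ : ℕ => ℂ) 2)) (ψ : ℕ → lp (fun _ : ℕ => ℂ) 2), (∀ i, 0 ≤ p i) → 0 ≤ W₀ → (∀ i : ℕ, IsSelfAdjoint (P i) ∧ IsCompactOperator (P i) ∧ (∀ v : lp (fun _ : ℕ => ℂ) 2, 0 ≤ RCLike.re (inner ℂ (P i v) v)) ∧ U i 0 = 1 ∧ (∀ x y : Fin 3 → ℤ, U i (x + y) = U i x * U i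 y) ∧ (∀ x y : Fin 3 → ℤ, (∀ k, ((x k : ℤ) : ZMod (2 * L + 1)) = ((y k : ℤ) : ZMod (2 * L + 1))) → U i x = U i y) ∧ (∀ (x : Fin 3 → ℤ) (v : lp (fun _ : ℕ => ℂ) 2), ‖U i x v‖ = ‖v‖) ∧ (∀ x : Fin 3 → ℤ, P i * U i x = U i x * P i)) → (∀ (H : ℝ) (f : SchwartzMap (EuclideanSpace ℝ (Fin 4)) ℝ), 2 * H + 3 * s ≤ s * T → tsupport (f : EuclideanSpace ℝ (Fin 4) → ℝ) ⊆ {y : EuclideanSpace ℝ (Fin 4) | 0 < y 0 ∧ y 0 ≤ H} → tsupport (f : EuclideanSpace ℝ (Fin 4) → ℝ) ⊆ {y : EuclideanSpace ℝ (Fin 4) | ∀ i : Fin 3, |y i.succ| < s * (L + 1 / 2)} → HasSum (fun i : ℕ => p i * ‖(∑' x : Fin 4 → ℤ, ((f (s • Literature.MathematicalPhysics.QuantumLattice.siteToE (d := 4) x) : ℝ) : ℂ) • ((P i ^ (Int.toNat (x 0 - 1))) ((U i (fun k : Fin 3 => x k.succ)) (ψ i))))‖ ^ 2) (Q f - W₀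 * (∑' x : Fin 4 → ℤ, f (s • Literature.MathematicalPhysics.QuantumLattice.siteToE (d := 4) x)) ^ 2)) → ∃ (W μ : ℕ → ℝ) (q : ℕ → Fin 3 → ℤ), (∀ n, 0 ≤ W n) ∧ (∀ n, 0 ≤ μ n) ∧ ∀ (H : ℝ) (f : SchwartzMap (EuclideanSpace ℝ (Fin 4)) ℝ), 2 * H + 3 * s ≤ s * T → tsupport (f : EuclideanSpace ℝ (Fin 4) → ℝ) ⊆ {y : EuclideanSpace ℝ (Fin 4) | 0 < y 0 ∧ y 0 ≤ H} → tsupport (f : EuclideanSpace ℝ (Fin 4) → ℝ) ⊆ {y : EuclideanSpace ℝ (Fin 4) | ∀ i : Fin 3, |y i.succ| < s * (L + 1 / 2)} → HasSum (fun n : ℕ => W n * ‖(∑' x : Fin 4 → ℤ, (((f (s • Literature.MathematicalPhysics.QuantumLattice.siteToE (d := 4) x) * μ n ^ (Int.toNat (x 0 - 1))) : ℝ) : ℂ) * Complex.exp (Complex.I * ((s * ∑ k : Fin 3, (2 * Real.pi * (q n k : ℝ) / (s * (2 * L + 1))) * (x k.succ : ℝ) : ℝ) : ℂ)))‖ ^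 2) (Q f)

end __Registered

/-! ## The two registered stubs — the ONLY `sorry`s of this file -/

/-- stub (L): torus OS / transfer-operator mixture data.  OPEN (lattice gauge theory, provable now). -/
theorem stub_torusMixtureData : __Registered.stub_torusMixtureData := by
  sorry

/-- stub (M): mixed joint diagonalisation + Parseval.  OPEN (pure operator theory + finite lattice support). -/
theorem stub_mixedParseval : __Registered.stub_mixedParseval := by
  sorry

/-! ## Composition: the crux BY NAME from the two stub statements (no `sorry` below) -/

/-- **TorusKL_of** — conclusion = the route decl `Summit.QuantumFields.YangMills.Theses.SqueezedSkewness.TorusKL`, by name. -/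
theorem TorusKL_of (h1 : __Registered.stub_torusMixtureData)
    (h2 : __Registered.stub_mixedParseval) :
    TorusKL := by
  intro G _ _ _ _ r St Cfg cc posE P A w E Cov refl B Qrp amp β L T s hβ hL hT hs
  obtain ⟨p, W₀, P', U, ψ, hp, hW₀, hprops, hsum⟩ := h1 G r β L T s hβ hL hT hs
  obtain ⟨W, μ, q, hW, hμ, hall⟩ :=
    h2 L T s hL hT hs (fun f => Qrp β (2 * L + 1) T s f) p W₀ P' U ψ hp hW₀ hprops hsum
  exact ⟨W, μ, q, hW, hμ, fun H f h0 h1' h2' => hall H f h0 h1' h2'⟩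

end Summit.QuantumFields.YangMills.Cruxes.NT.TorusKLBirth
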